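import Summits.Langlands.Langlands.Theorems.IrreducibilityBySelfDualityPairLBoundaryJSTransferMapLine
import Summits.Langlands.Langlands.Theorems.IrreducibilityBySelfDualityPairLBoundaryJSSpreadPairDatum

/-!
# Crux `PairLBoundaryJS` (stmt-Langlands-13622), line `Sketch` — stub `stub_translate_arch_value` (L2):
# the archimedean value of the translated Whittaker coefficient of a smoothed spread pure tensor

Summit `Langlands`, sub-problem `Langlands`, helper file under `Theorems/` supporting the crux
`PairLBoundaryJS` (Arthur–Clozel (1989), Ch. 3, (2.2)), line `Sketch`, registered stub
`stub_translate_arch_value`.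

Setting (tree vocabulary: `CuspidalRepFiniteComponent`, `WhittakerUniquenessReduction`,
`TransferMapLine`, `PairLFunctionPolesEqConjArch`). `Π` is a cuspidal automorphic representation of
`GL_n(𝔸_K)`, `τ` its archimedean component, `M = multiplicityModule ≅ π_f`, `λ` the global Whittaker
functional `whittakerFunctional ν₀ (continuous_adeleAddChar K) (Equiv.refl Π)` and `Φ_λ = transferMap λ`,
`Φ_λ(S)(w) = λ(Ŝ w)`. For `S₁ ∈ π_f` of level `K_f(𝔫₁)`, a Gårding vector `x` of `τ`, the pure tensor
`y = Ŝ₁ x ∈ Π` and its spread `f = E_L y` (`spreadIter`, places `L` with `exp(-e_v) ≤ |𝔫₁|_v`), a test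
function `η` with `R(η) f = a f`, and `D ∈ GL_n(𝔸_K)` trivial at the places of `L` and at `∞` with
`D_f⁻¹ K_f(𝔫₁ 𝔞) D_f ≤ K_f(𝔫₁)` for an ideal `𝔞` prime to `L`:

  `W_{S_η f}(D · (h, 1)) = a · Φ_λ(D_f · S₁)(τ(h) x)`  for every `h ∈ GL_n(K_∞)`.

Proof (Cogdell (2004), §1.1–§1.2, `W_φ(g) = Λ(π(g) φ)` and `W_φ = ∏_v W_v` for decomposable `φ`):
`W_{S_η f}(g) = λ(R(g) S_η f) = a λ(R(g) E_L y)` (`whittakerFunctional_toContRep_eq_whittakerCoeff`); for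
`g = D (h, 1)`, trivial at `L`, (I1) `toContRep_spreadIter` gives `R(g) E_L y = E_L R(g) y`; `R(g) y` is a
Gårding vector fixed by `K(𝔫₁ 𝔞)` (`g⁻¹ k g = (1, D_f⁻¹ k_f D_f)` with `D_f⁻¹ k_f D_f ∈ K_f(𝔫₁)`, the level of
`S₁`), and `|𝔫₁ 𝔞|_v = |𝔫₁|_v` on `L` (`idealRadius_mul`, `idealRadius_eq_one_of_not_dvd`), so (I4)
`whittakerFunctional_spreadIter` removes `E_L`: `λ(E_L R(g) y) = λ(R(g) y)`; finally
`λ(R(g) Ŝ₁ x) = Φ_λ(g_f · S₁)(τ(g_∞) x)` (`TransferMapLine.apply_toContRep_corestrictW_eq_transferMap`) with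
`g_f = D_f` and `g_∞ = h`. All proofs complete; tree theorems only.

## References

* J. W. Cogdell, *Lectures on L-functions, converse theorems, and functoriality for GL_n*, Fields
  Inst. Monogr. 20 (2004), §1.1–§1.2 [CogdellAnalyticTheory2004].
* H. Jacquet, J. A. Shalika, *On Euler products and the classification of automorphic
  representations I*, Amer. J. Math. 103 (1981), §4–§5 [JacquetShalikaAJM1981].
-/

noncomputable section

-- `Summit.Langlands.Langlands.…` (summit = sub-problem name, D-0017 layout) trips `dupNamespace`
set_option linter.dupNamespace false

open scoped MatrixGroups Topology Pointwise ENNReal NNReal ComplexConjugate InnerProductSpace ContDiff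
-- the place subtypes indexing `mixedSpace K` are `Fintype` classically (`NormedCommRing (mixedSpace K)`)
open scoped Classical Matrix.Norms.Operator
open NumberField IsDedekindDomain MeasureTheory Measure Matrix Set Filter WithZero
open NumberField.mixedEmbedding
open Literature.NumberTheory.Automorphic AdelicGroupData
open Literature.NumberTheory.GaloisRepresentations (ideleGroup HeckeCharacter)
open ValuativeRel

-- the automorphic quotient carries the tree's Borel σ-algebra, not Mathlib's quotient σ-algebra
attribute [-instance] Quotient.instMeasurableSpace QuotientGroup.measurableSpace

-- the house local instances, exactly as in `RankinSelbergUnfoldingIdentity`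
attribute [local instance] adelicBorel borelSpace_adelic locallyCompactSpace_adelic secondCountableTopology_gl_adelic
  glAdeleBorel borelSpace_glAdele borelSpace_ideleGroup secondCountableTopology_ideleGroup

-- Mathlib idiom: the commutator Lie ring on matrices, to mention `(archGroupGL n K).lie`
attribute [local instance 100] LieRing.ofAssociativeRing

namespace Summit.Langlands.Langlands.Theorems.TranslateArchValue

variable {n : ℕ} {K : Type} [Field K] [NumberField K]
  {μ : Measure (AdelicGroupData.gl n K).automorphicQuotient} [(AdelicGroupData.gl n K).IsAutomorphicMeasure μ]
  {hcpt : isCompact_glFiniteIntegralLevel n K}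
  {E : Type*} [NormedAddCommGroup E] [InnerProductSpace ℂ E] [CompleteSpace E]
  {τ : ContRepresentation ℂ (AutomorphyDatum.gl n K hcpt).arch.carrier E}

/-! ### 1. The pure tensor `Ŝ₁ x` and its translates: level -/

omit [CompleteSpace E] in
/-- **The pure tensor `Ŝ x` of an intertwiner `S` of level `U₀` is fixed by `(1, U₀)`**: for `u ∈ U₀`,
`R((1, u)) Ŝ x = Ŝ x` (the range of `S` lies in the level piece `Π^{U₀}`, `mem_levelPiece_iff`). [folklore] -/
theorem toContRep_ofFinite_corestrictW_eq_self
    {W : ContRepresentation.ClosedSubrep ((AdelicGroupData.gl n K).rightRegular μ)}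
    {U₀ : Subgroup (GL (Fin n) (FiniteAdeleRing (𝓞 K) K))} {S : E →L[ℂ] (AdelicGroupData.gl n K).L2 μ}
    (hS : S ∈ archIntertwinersLevel hcpt τ W U₀) (hS' : S ∈ archIntertwiners hcpt τ W)
    {u : GL (Fin n) (FiniteAdeleRing (𝓞 K) K)} (hu : u ∈ U₀) (x : E) :
    W.toContRep (GLn.ofFinite n K u) (corestrictW hS' x) = corestrictW hS' x := by
  apply Subtype.ext
  rw [ContRepresentation.ClosedSubrep.coe_toContRep_apply, coe_corestrictW_apply]
  exact (mem_levelPiece_iff.mp (hS.2 x)).2 u hu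

omit [CompleteSpace E] in
/-- **The level of a translate of a pure tensor.** Let `S` be an intertwiner of level `K_f(𝔫₁)`,
`g ∈ GL_n(𝔸_K)` and `𝔫₂` an ideal with `g_f⁻¹ K_f(𝔫₂) g_f ≤ K_f(𝔫₁)`. Then `R(g) Ŝ x` is fixed by
`K(𝔫₂)`: for `k ∈ K(𝔫₂) = (1, K_f(𝔫₂))`, `k g = g (g⁻¹ k g) = g (1, g_f⁻¹ k_f g_f)`
(`GLn.inv_mul_mul_eq_ofFinite`) and `(1, g_f⁻¹ k_f g_f)` fixes `Ŝ x`. [folklore] -/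
theorem toContRep_toContRep_corestrictW_eq_of_conj
    {W : ContRepresentation.ClosedSubrep ((AdelicGroupData.gl n K).rightRegular μ)}
    {𝔫₁ 𝔫₂ : Ideal (𝓞 K)} {S : E →L[ℂ] (AdelicGroupData.gl n K).L2 μ}
    (hS : S ∈ archIntertwinersLevel hcpt τ W (finitePrincipalCongruenceLevel n K 𝔫₁))
    (hS' : S ∈ archIntertwiners hcpt τ W) (g : GL (Fin n) (AdeleRing (𝓞 K) K))
    (hg : ∀ u ∈ finitePrincipalCongruenceLevel n K 𝔫₂,
      (GLn.sndHom n K g)⁻¹ * u * GLn.sndHom n K g ∈ finitePrincipalCongruenceLevel n K 𝔫₁)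
    (x : E) {k : GL (Fin n) (AdeleRing (𝓞 K) K)} (hk : k ∈ principalCongruenceLevel n K 𝔫₂) :
    W.toContRep k (W.toContRep g (corestrictW hS' x)) = W.toContRep g (corestrictW hS' x) := by
  have hk1 : GLn.ofFinite n K (GLn.sndHom n K k) = k :=
    GLn.ofFinite_sndHom_of_mem (principalCongruenceLevel_le n K 𝔫₂ hk)
  have hk2 : GLn.sndHom n K k ∈ finitePrincipalCongruenceLevel n K 𝔫₂ := by
    rw [mem_finitePrincipalCongruenceLevel_iff, hk1]; exact hk
  have hkf : GLn.fstHom n K k = 1 := by rw [← hk1, GLn.fstHom_ofFinite]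
  have hkg : k * g = g * GLn.ofFinite n K ((GLn.sndHom n K g)⁻¹ * GLn.sndHom n K k * GLn.sndHom n K g) := by
    rw [← GLn.inv_mul_mul_eq_ofFinite hkf g, ← mul_assoc, ← mul_assoc, mul_inv_cancel, one_mul]
  rw [← Literature.NumberTheory.Automorphic.ClosedSubrep.toContRep_mul_apply, hkg,
    Literature.NumberTheory.Automorphic.ClosedSubrep.toContRep_mul_apply,
    toContRep_ofFinite_corestrictW_eq_self hS hS' (hg _ hk2) x]

/-! ### 2. The registered stub -/

/-- **STUB (L2, engineering) — the archimedean value of the TRANSLATED Whittaker coefficient of a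
smoothed spread pure tensor.** For `f = E_L (Ŝ₁ x)` (`spreadIter` of the pure tensor `Ŝ₁ x`, `S₁ ∈ π_f` of level
`K_f(𝔫₁)`, `x` a Gårding vector of the archimedean component `τ`), a test function `η` with `R(η) f = a f`, and
`D ∈ GL_n(𝔸_K)` with trivial components at the places of `L` and at `∞` such that `D_f⁻¹ K_f(𝔫₁ 𝔞) D_f ≤ K_f(𝔫₁)`
for an ideal `𝔞` prime to `L`: `W_{S_η f}(D · (h, 1)) = a · Φ_λ(D_f · S₁)(τ(h) x)` for every `h ∈ GL_n(K_∞)`.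
Proof: `W_{S_η f}(g) = λ(R(g) S_η f) = a λ(R(g) E_L (Ŝ₁ x))` (`whittakerFunctional_toContRep_eq_whittakerCoeff`); for
`g = D (h,1)` trivial at `L`, (I1) `toContRep_spreadIter` moves `R(g)` inside, (I4) `whittakerFunctional_spreadIter`
(level `𝔫₁ 𝔞`: `R(g) Ŝ₁ x` is Gårding and `K(𝔫₁ 𝔞)`-fixed; `idealRadius K v (𝔫₁ 𝔞) = idealRadius K v 𝔫₁` on `L`,
`idealRadius_mul`) removes `E_L`, and `apply_toContRep_corestrictW_eq_transferMap` (`TransferMapLine`) evaluates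
`λ(R(g) Ŝ₁ x)` with `sndHom g = D_f`, `toMixed g = h`. With `L = []` this is the un-spread partner.
[cite: CogdellAnalyticTheory2004, §1.2] -/
theorem stub_translate_arch_value :
    ∀ {n : ℕ} {K : Type} [Field K] [NumberField K]
      {μ : Measure (AdelicGroupData.gl n K).automorphicQuotient} [(AdelicGroupData.gl n K).IsAutomorphicMeasure μ]
      [MeasurableSpace (AdeleRing (𝓞 K) K)] [BorelSpace (AdeleRing (𝓞 K) K)]
      (hcpt : isCompact_glFiniteIntegralLevel n K) (P : CuspidalAutomorphicRepGL n K μ)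
      {E : Type} [NormedAddCommGroup E] [InnerProductSpace ℂ E] [CompleteSpace E]
      {τ : ContRepresentation ℂ (AutomorphyDatum.gl n K hcpt).arch.carrier E} (hτc : τ.IsStronglyContinuous)
      (ν₀ : Measure ↥(adelicUnipotent n K)) [IsHaarMeasure ν₀]
      {𝔫₁ : Ideal (𝓞 K)} (_ : 𝔫₁ ≠ 0) (S₁ : multiplicityModule hcpt τ P.1)
      (_ : (S₁ : E →L[ℂ] (AdelicGroupData.gl n K).L2 μ) ∈ archIntertwinersLevel hcpt τ P.1 (finitePrincipalCongruenceLevel n K 𝔫₁))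
      (x : archGardingSpace hcpt τ)
      {c e : HeightOneSpectrum (𝓞 K) → ℤ} {ϖ : ∀ v : HeightOneSpectrum (𝓞 K), (v.adicCompletion K)ˣ}
      {L : List (HeightOneSpectrum (𝓞 K))} (_ : ∀ v ∈ L, SpreadHyp (K := K) c e ϖ v) (_ : L.Nodup)
      (_ : ∀ v ∈ L, exp (-e v) ≤ idealRadius K v 𝔫₁)
      (D : GL (Fin n) (AdeleRing (𝓞 K) K)) (_ : ∀ v ∈ L, localComponent v D = 1) (_ : GLn.toMixed n K D = 1)
      {𝔞 : Ideal (𝓞 K)} (_ : 𝔞 ≠ 0) (_ : ∀ v ∈ L, ¬ v.asIdeal ∣ 𝔞)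
      (_ : ∀ u ∈ finitePrincipalCongruenceLevel n K (𝔫₁ * 𝔞),
        (GLn.sndHom n K D)⁻¹ * u * GLn.sndHom n K D ∈ finitePrincipalCongruenceLevel n K 𝔫₁)
      {η : GL (Fin n) (AdeleRing (𝓞 K) K) → ℝ} (_ : IsTestFunctionGL n K η) {a : ℂ} (f : P.1.toSubmodule)
      (_ : f = spreadIter P.1 c e ϖ L (corestrictW (mem_archIntertwiners_of_mem_multiplicityModule S₁.2) (x : E)))
      (_ : smoothedVector P.1 η f = a • f) (h : GL (Fin n) (mixedSpace K)),
    whittakerCoeff ν₀ (unipotentTateDomain n K) (adeleAddChar K) (invQuot (AdelicGroupData.gl n K) (smoothedForm η ((f : P.1.toSubmodule) : (AdelicGroupData.gl n K).L2 μ))) (D * GLn.ofInfinite n K h) =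
      a * transferMap (whittakerFunctional ν₀ (continuous_adeleAddChar K) (ContRepresentation.Equiv.refl P.1.toContRep)) hτc
        (finComponentRep hcpt τ P.1 (GLn.sndHom n K D) S₁) ⟨τ (toArch hcpt h) (x : E), apply_mem_archGardingSpace hτc _ x.2⟩ := by
  intro n K _ _ μ _ _ _ hcpt P E _ _ _ τ hτc ν₀ _ 𝔫₁ h𝔫₁ S₁ hS₁ x c e ϖ L hL hnd hrad D hDL hDinf 𝔞 h𝔞 h𝔞L hDconj η hη a
    f hf hηf h
  -- the pure tensor `y = Ŝ₁ x`, the point `g = D (h, 1)`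
  set y : P.1.toSubmodule := corestrictW (mem_archIntertwiners_of_mem_multiplicityModule S₁.2) (x : E) with hydef
  set g : GL (Fin n) (AdeleRing (𝓞 K) K) := D * GLn.ofInfinite n K h with hgdef
  have hsnd : GLn.sndHom n K g = GLn.sndHom n K D := by
    rw [hgdef, map_mul, GLn.sndHom_ofInfinite, mul_one]
  have hmix : GLn.toMixed n K g = h := by
    rw [hgdef, map_mul, hDinf, one_mul, GLn.toMixed_ofInfinite]
  have hg : ∀ v ∈ L, localComponent v g = 1 := fun v hv => by
    have h1 : localComponent v g = localComponent v D * localComponent v (GLn.ofInfinite n K h) := map_mul _ _ _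
    rw [h1, hDL v hv, one_mul]
    exact localComponent_ofInfinite h
  -- (1) `W_{S_η f}(g) = λ(R(g) S_η f)`
  have huG : smoothedVector P.1 η f ∈ gardingSpace P.1 := smoothedVector_mem_gardingSpace hη f
  rw [← whittakerFunctional_toContRep_eq_whittakerCoeff ν₀ (continuous_adeleAddChar K) huG
    (hasContRep_smoothedVector P.1 hη.continuous hη.hasCompactSupport f) g]
  -- (2)–(3) `R(g) y` is a Gårding vector fixed by `K(𝔫₁ 𝔞)`; (I4) at the level `𝔫₁ 𝔞`
  have hyG : y ∈ gardingSpace P.1 := corestrictW_mem_gardingSpace_of_mem_multiplicityModule S₁.2 hτc x.2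
  have hy'G : P.1.toContRep g y ∈ gardingSpace P.1 := toContRep_mem_gardingSpace g hyG
  have h𝔫₁𝔞 : 𝔫₁ * 𝔞 ≠ 0 := mul_ne_zero h𝔫₁ h𝔞
  have hrad' : ∀ v ∈ L, exp (-e v) ≤ idealRadius K v (𝔫₁ * 𝔞) := fun v hv => by
    rw [idealRadius_mul v h𝔫₁ h𝔞, idealRadius_eq_one_of_not_dvd h𝔞 (h𝔞L v hv), mul_one]
    exact hrad v hv
  have hDconj' : ∀ u ∈ finitePrincipalCongruenceLevel n K (𝔫₁ * 𝔞),
      (GLn.sndHom n K g)⁻¹ * u * GLn.sndHom n K g ∈ finitePrincipalCongruenceLevel n K 𝔫₁ := by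
    rw [hsnd]; exact hDconj
  have hy'fix : ∀ k ∈ principalCongruenceLevel n K (𝔫₁ * 𝔞), P.1.toContRep k (P.1.toContRep g y) = P.1.toContRep g y :=
    fun k hk => toContRep_toContRep_corestrictW_eq_of_conj hS₁ _ g hDconj' (x : E) hk
  obtain ⟨hE, hℓ⟩ := whittakerFunctional_spreadIter ν₀ h𝔫₁𝔞 hL hnd hrad' hy'G hy'fix
    (W := P.1) (c := c) (e := e) (ϖ := ϖ) (L := L)
  -- (2) `R(g) S_η f = a • E_L (R(g) y)` by (I1)
  have hvec : (⟨P.1.toContRep g (smoothedVector P.1 η f), toContRep_mem_gardingSpace g huG⟩ : gardingSpace P.1) =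
      a • ⟨spreadIter P.1 c e ϖ L (P.1.toContRep g y), hE⟩ := by
    apply Subtype.ext
    change P.1.toContRep g (smoothedVector P.1 η f) = a • spreadIter P.1 c e ϖ L (P.1.toContRep g y)
    rw [hηf, map_smul, hf, toContRep_spreadIter hL hg]
  rw [hvec, map_smul, smul_eq_mul, hℓ]
  congr 1
  -- (4) `λ(R(g) Ŝ₁ x) = Φ_λ(g_f · S₁)(τ(g_∞) x)` with `g_f = D_f`, `g_∞ = h`
  rw [TransferMapLine.apply_toContRep_corestrictW_eq_transferMap _ hτc S₁ x g hy'G, hsnd]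
  congr 1
  apply Subtype.ext
  change τ (toArch hcpt (GLn.toMixed n K g)) (x : E) = τ (toArch hcpt h) (x : E)
  rw [hmix]

end Summit.Langlands.Langlands.Theorems.TranslateArchValue
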